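import Summits.CriticalPhenomena.PercolationContinuityZ3.Theorems.SahiMasterFamilyDetector2Cored

/-!
# The cored `r_e = 2` detector of `E_4` under (P3+) "`E₃` of a non-zero-flag triple is positive somewhere"

Companion of `SahiMasterFamilyDetector2Cored` (crux `NoHeavyLowerTail`, stmt-CriticalPhenomena-4575; cell `prim-masterthm`, seat P4, unit
`prim-masterthm-p4-g10`; seat memo HOME/prim-masterthm-p4/R42-CORED.md §2, §4).  There the cored `r_e = 2` coordinate detector was proved OFF the
residual class `𝓡₃` (where the tree has `E₃ ≥ 0`).  Here the same detector is proved for EVERY triple, conditionally on the typed statement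
* `SahiE3PositiveSomewhere` (P3+): a triple of increasing events which is not a zero flag has `E₃(μ_p) > 0` at SOME interior `p`.
(P3+) is implied by Sahi's `C₃` / Kahn's Conjecture 5 at `n = 3` (with the tree's (EQI-3)); the memo (§4) reduces it to prim-master-conj's order-3
tightness (FVT_3) through P4's principal-cap dichotomy (PCD) and the OR-triangle.  With it:
* `suppZeroFlag_three_of_cored_coordinate_of_positiveSomewhere`: if `E_4 ≡ 0` on the open cube for a quadruple of increasing events and the coordinate
  `e` is `r_e = 2` and cored for exactly the member `U_1` (acts on `U_0`, lies in every configuration of `U_1`, does not act on `U_2, U_3`), then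
  `(U_1, U_2, U_3)` is a zero flag — so in a quadruple with no `Z_3` sub-triple every such coordinate detects `E_4 ≢ 0`.
HONEST FRAMING: a conditional reduction; (P3+), R₄^{(2)}, Sahi `C_k` and the master theorem remain OPEN.  [this work]
-/

noncomputable section

open scoped Classical

namespace Summit.CriticalPhenomena.PercolationContinuityZ3.Theorems

open Finset Function
open Literature.Combinatorics.Sahi2008
open Literature.Probability.Percolation.DecisionTree (ind ind_of_mem ind_of_not_mem ind_nonneg)
open Literature.Probability.LatticeModels.Kahn2022 (Affects)
open SharedCoordinate (pivSet)

/-- **(P3+) `E₃` of a non-zero-flag triple of increasing events is positive somewhere.**  For three increasing events of a finite product space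
that do NOT form a zero flag, `E₃(μ_p; 1_U) > 0` at some interior `p`.  [this work] [status: open — our conjecture; implied by Sahi's `C₃`
(Kahn's Conjecture 5, `n = 3`) together with the tree's (EQI-3) `masterFamilyIdentEqIff_three`; reduced in the seat memo R42-CORED.md §4 to the
order-3 tightness statement (FVT_3) of prim-master-conj via PCD; holds on the non-residual strata by `sahiE_three_ind_nonneg_of_not_residual`] -/
@[conjecture] def SahiE3PositiveSomewhere : Prop :=
  ∀ (ι : Type) [Fintype ι] (U : Fin 3 → Set (Set ι)), (∀ j, IsUpperSet (U j)) → ¬ SuppZeroFlag 3 U →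
    ∃ p : ι → unitInterval, (∀ i, (p i : ℝ) ∈ Set.Ioo (0 : ℝ) 1) ∧ 0 < sahiE (bernoulliWeight p) 3 (fun j => ind (U j))

variable {ι : Type} [Fintype ι]

/-- **The cored `r_e = 2` detector, general form under (P3+).**  Four increasing events with `E_4(μ_p; 1_U) = 0` at every interior `p`; the
coordinate `e` acts on `U_0`, lies in the core of `U_1` (`U_1^{e←0} = ∅`) and does not act on `U_2, U_3`.  Then `(U_1, U_2, U_3)` is a zero flag.
Proof: at every interior base point the explicit detector gives `Ψ = 0`, the four-term identity and Harris give `E₃(U_1^{e←1}, U_2, U_3) ≤ 0` there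
(`sahiE_three_nonpos_of_psiDet_eq_zero`, transported off `p_e` by `sahiE_three_secAt_update`); by (P3+) the contraction triple is a zero flag, and
private gluing with the empty deletion `U_1^{e←0}` lifts it. [this work] -/
theorem suppZeroFlag_three_of_cored_coordinate_of_positiveSomewhere (hP3 : SahiE3PositiveSomewhere) (e : ι)
    (U : Fin 4 → Set (Set ι)) (hU : ∀ j, IsUpperSet (U j)) (he₀ : Affects (U 0) e) (hcore : secAt e false (U 1) = ∅)
    (he₂ : ¬ Affects (U 2) e) (he₃ : ¬ Affects (U 3) e)
    (h : ∀ p : ι → unitInterval, (∀ i, (p i : ℝ) ∈ Set.Ioo (0 : ℝ) 1) →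
      sahiE (bernoulliWeight p) 4 (fun j => ind (U j)) = 0) :
    SuppZeroFlag 3 ![U 1, U 2, U 3] := by
  set V : Fin 3 → Set (Set ι) := ![U 1, U 2, U 3] with hV
  have hVup : ∀ j, IsUpperSet (V j) := by intro j; fin_cases j <;> simp [hV, hU]
  have hs2 : secAt e true (U 2) = U 2 := secAt_eq_self_of_not_affects (hU 2) he₂ true
  have hs3 : secAt e true (U 3) = U 3 := secAt_eq_self_of_not_affects (hU 3) he₃ true
  set U' : Fin 3 → Set (Set ι) := fun j => secAt e true (V j) with hU'
  have hU'up : ∀ j, IsUpperSet (U' j) := fun j => isUpperSet_secAt e true (hVup j)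
  have hF : (fun j => ind (U' j)) = ![ind (secAt e true (U 1)), ind (U 2), ind (U 3)] := by
    funext j; fin_cases j
    · rfl
    · show ind (secAt e true (U 2)) = ind (U 2); rw [hs2]
    · show ind (secAt e true (U 3)) = ind (U 3); rw [hs3]
  have hP1 : pivSet e (U 1) = secAt e true (U 1) := by rw [pivSet, hcore, Set.sdiff_empty]
  -- `E₃` of the contraction triple is `≤ 0` at every interior point
  have hle : ∀ q : ι → unitInterval, (∀ i, (q i : ℝ) ∈ Set.Ioo (0 : ℝ) 1) →
      sahiE (bernoulliWeight q) 3 (fun j => ind (U' j)) ≤ 0 := by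
    intro q hq
    -- the fibre over `q` lies in the open cube
    have hfib : ∀ s : unitInterval, (s : ℝ) ∈ Set.Ioo (0 : ℝ) 1 →
        sahiE (bernoulliWeight (update q e s)) 4 (fun j => ind (U j)) = 0 := by
      intro s hs
      refine h (update q e s) fun i => ?_
      by_cases hi : i = e
      · subst hi; rw [update_self]; exact hs
      · rw [update_of_ne hi]; exact hq i
    have hψ := psiDet_pivSet_eq_zero_of_forall_sahiE_four_eq_zero q e U hU he₂ he₃ hfib
    rw [hP1] at hψ
    have h0 := sahiE_three_nonpos_of_psiDet_eq_zero (update q e 0) (isUpperSet_secAt e true (hU 1)) (hU 2) (hU 3)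
      (ex_ind_pivSet_pos q hq e he₀) hψ
    have htr := sahiE_three_secAt_update q e true 0 (q e) V
    rw [update_eq_self] at htr
    rw [← htr, hF]
    exact h0
  -- hence a zero flag, by (P3+)
  have hZ1 : SuppZeroFlag 3 U' := by
    by_contra hnot
    obtain ⟨q, hq, hpos⟩ := hP3 ι U' hU'up hnot
    exact absurd (hle q hq) (not_le.2 hpos)
  have hZ0 : SuppZeroFlag 3 (fun j => secAt e false (V j)) :=
    suppZeroFlag_of_mem_empty 2 _ 0 (by simp [hV, hcore])
  have heV : ∀ j : Fin 3, j ≠ 0 → ¬ Affects (V j) e := by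
    intro j hj; fin_cases j
    · exact absurd rfl hj
    · exact he₂
    · exact he₃
  exact suppZeroFlag_of_minors_of_private V hVup 0 e heV hZ0 hZ1

end Summit.CriticalPhenomena.PercolationContinuityZ3.Theorems
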